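import Mathlib.Analysis.Calculus.BumpFunction.FiniteDimension
import Mathlib.Analysis.Calculus.ContDiff.Operations
import HarnessLib

/-!
# Smooth cutoff: a `C^n` function whose restriction along a continuous map has compact support agrees, along that map, with a
# `C^n` function of compact support (Lee, *Introduction to Smooth Manifolds*, Prop. 2.25 ∕ Lemma 2.26; Hörmander ALPDO I, Thm. 1.4.1)

Topic `Analysis/Calculus`; namespace `Literature.Analysis.Calculus`.  THEOREMS ONLY (no `def`, no instance, no notation, no axiom, no `sorry`);
generic over a finite-dimensional real normed space `E` and a real normed space `F`.

MOTIVATION (cell `pub/hodgecm-mathlib`, LEAD F0P3a-plan (g9) ruling T8-19 (β), 2026-09-01, author B-p17 (g23)): the archimedean test-function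
currency of the cell is an AMBIENT function `Θ : Matrix (Fin N) (Fin N) ℂ → E` that is smooth on the matrix space and whose restriction to the closed
subgroup `G_w ⊆ GL_N(ℂ) ⊆ M_N(ℂ)` has compact support; orbital integrals only see `Θ` on `G_w`.  This file supplies the CUTOFF LEMMA that lets every
such `Θ` be replaced, without changing anything on the group, by an ambient-smooth function of AMBIENT compact support — so statements may be made in
either currency.  (Smoothness exponents are `n : ℕ∞`, i.e. up to `C^∞`; the analytic class `ω = ⊤ : WithTop ℕ∞` is excluded on purpose: a compactly
supported analytic function vanishes.)

WHAT IS PROVED.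
* §1 `exists_contDiff_hasCompactSupport_eq_one_of_isCompact` — for compact `K ⊆ E` a smooth `χ : E → [0,1]` of compact support with `χ = 1` on `K`
  (Mathlib's `ContDiffBump` centred at `0` with inner radius past `K`).
* §2 `exists_contDiff_hasCompactSupport_comp_eq` — MAIN: `ι : X → E` continuous, `Θ : E → F` of class `C^n`, `Θ ∘ ι` compactly supported (in `X`) ⇒
  `∃ Θ'`, `C^n`, compactly supported in `E`, `‖Θ' v‖ ≤ ‖Θ v‖` everywhere, and `Θ' (ι x) = Θ (ι x)` for EVERY `x : X` (`Θ' := χ • Θ` with `χ = 1` on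
  `ι '' tsupport (Θ ∘ ι)`; off that support both sides vanish);
  `exists_contDiff_hasCompactSupport_eqOn` — the same for a subset `s ⊆ E` (`ι = Subtype.val`), conclusion `Set.EqOn Θ' Θ s`.

## References
* [Lee2012] J. M. Lee, *Introduction to Smooth Manifolds*, 2nd ed., GTM 218 (2012), Prop. 2.25 (smooth bump functions for a closed set), Lemma 2.26
  (extension lemma for smooth functions).
* [HormanderALPDO1] L. Hörmander, *The Analysis of Linear Partial Differential Operators I* (1983), Thm. 1.4.1 (cutoff functions equal to `1` near a
  compact set).
-/

set_option autoImplicit false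

namespace Literature.Analysis.Calculus

open Set Metric Function

variable {E F : Type*} [NormedAddCommGroup E] [NormedSpace ℝ E] [FiniteDimensional ℝ E]
  [NormedAddCommGroup F] [NormedSpace ℝ F]

/-! ## §1 A smooth compactly supported cutoff equal to `1` on a compact set -/

/-- **Cutoff functions.**  For a compact subset `K` of a finite-dimensional real normed space there is a function `χ : E → ℝ`, of class `C^n` for
every `n : ℕ∞`, with compact support, values in `[0, 1]`, and `χ = 1` on `K`.
[cite: HormanderALPDO1, Thm. 1.4.1] [cite: Lee2012, Prop. 2.25] -/
theorem exists_contDiff_hasCompactSupport_eq_one_of_isCompact {K : Set E} (hK : IsCompact K) :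
    ∃ χ : E → ℝ, (∀ n : ℕ∞, ContDiff ℝ n χ) ∧ HasCompactSupport χ ∧ (∀ v ∈ K, χ v = 1) ∧
      ∀ v, χ v ∈ Icc (0 : ℝ) 1 := by
  obtain ⟨r, hr, hKr⟩ := hK.isBounded.subset_closedBall_lt 0 (0 : E)
  let χ : ContDiffBump (0 : E) := ⟨r, r + 1, hr, by linarith⟩
  refine ⟨χ, fun n => χ.contDiff, χ.hasCompactSupport, fun v hv => χ.one_of_mem_closedBall (hKr hv),
    fun v => ⟨χ.nonneg, χ.le_one⟩⟩

/-! ## §2 Modifying a `C^n` function off a set on which it is compactly supported -/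

/-- **Cutoff lemma (along a continuous map).**  Let `ι : X → E` be continuous (e.g. the inclusion of a closed subgroup of `GL_N` into the matrix
space), `Θ : E → F` of class `C^n` (`n : ℕ∞`), and suppose `Θ ∘ ι` has compact support in `X`.  Then there is `Θ' : E → F` of class `C^n` WITH
COMPACT SUPPORT IN `E`, pointwise dominated by `Θ` in norm, and agreeing with `Θ` along `ι`: `Θ' (ι x) = Θ (ι x)` for every `x`.
(`Θ' = χ • Θ` for a cutoff `χ = 1` on the compact set `ι '' tsupport (Θ ∘ ι)`.)
[cite: Lee2012, Lemma 2.26] [cite: HormanderALPDO1, Thm. 1.4.1] -/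
theorem exists_contDiff_hasCompactSupport_comp_eq {X : Type*} [TopologicalSpace X] {ι : X → E}
    (hι : Continuous ι) {n : ℕ∞} {Θ : E → F} (hΘ : ContDiff ℝ n Θ) (hc : HasCompactSupport (Θ ∘ ι)) :
    ∃ Θ' : E → F, ContDiff ℝ n Θ' ∧ HasCompactSupport Θ' ∧ (∀ v, ‖Θ' v‖ ≤ ‖Θ v‖) ∧
      ∀ x, Θ' (ι x) = Θ (ι x) := by
  obtain ⟨χ, hχd, hχc, hχ1, hχ01⟩ :=
    exists_contDiff_hasCompactSupport_eq_one_of_isCompact (hc.image hι)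
  refine ⟨fun v => χ v • Θ v, (hχd n).smul hΘ, hχc.smul_right, fun v => ?_, fun x => ?_⟩
  · show ‖χ v • Θ v‖ ≤ ‖Θ v‖
    rw [norm_smul, Real.norm_of_nonneg (hχ01 v).1]
    exact mul_le_of_le_one_left (norm_nonneg _) (hχ01 v).2
  · show χ (ι x) • Θ (ι x) = Θ (ι x)
    by_cases hx : x ∈ tsupport (Θ ∘ ι)
    · rw [hχ1 (ι x) (mem_image_of_mem ι hx), one_smul]
    · rw [show Θ (ι x) = 0 from image_eq_zero_of_notMem_tsupport (f := Θ ∘ ι) hx, smul_zero]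

/-- **Cutoff lemma (on a subset).**  If `Θ : E → F` is of class `C^n` and its restriction to a subset `s ⊆ E` has compact support (in the subspace
topology of `s`), then some `Θ' : E → F` of class `C^n` with compact support in `E`, pointwise dominated by `Θ` in norm, agrees with `Θ` on `s`.
[cite: Lee2012, Lemma 2.26] [cite: HormanderALPDO1, Thm. 1.4.1] -/
theorem exists_contDiff_hasCompactSupport_eqOn {s : Set E} {n : ℕ∞} {Θ : E → F} (hΘ : ContDiff ℝ n Θ)
    (hc : HasCompactSupport (fun x : s => Θ x)) :
    ∃ Θ' : E → F, ContDiff ℝ n Θ' ∧ HasCompactSupport Θ' ∧ (∀ v, ‖Θ' v‖ ≤ ‖Θ v‖) ∧ EqOn Θ' Θ s := by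
  obtain ⟨Θ', h1, h2, h3, h4⟩ :=
    exists_contDiff_hasCompactSupport_comp_eq (ι := (Subtype.val : s → E)) continuous_subtype_val hΘ hc
  exact ⟨Θ', h1, h2, h3, fun v hv => h4 ⟨v, hv⟩⟩

end Literature.Analysis.Calculus
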